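import Mathlib
import Summits.Ventures.PercRepro2.CutTwoFarOB
import Summits.Ventures.PercRepro2.LeafStep
import Summits.Ventures.PercRepro2.LeafRowCoincidences

/-!
# `o` and `b` together behind a cut vertex: row (LEAF-½) by the diagonal reduction
(blind cell PercRepro2, p5 g29; `proofs/P5-OEDGE.md` §38 (4) / §39)

typer-1's two-far-mark machinery for the role pair `{o, b}` (`CutTwoFarOB*.lean`: the left
pattern of `{v, o, b}`, the right pattern of `{v, a₁, a₂, a₃}`, every mass a bilinear form in the
five pattern probabilities `q` and the fifteen right atoms `r`) carries the middle Bernstein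
coefficient `R½` of the leaf step (`LeafStep.Rhalf`, the five marks `o, a₁, a₂, a₃, b` with `a₃`
in the slot of the attachment vertex `v` of the row) exactly as it carries `Gc`:

  **`Rhalf_obFar_eq`**: with `o, b` behind the cut vertex `v` and `a₁, a₂, a₃` on the right
  (or at `v`),
  `R½ = P₁ P₂ · R½(o := v, b := v) + (q_all − P₁ P₂) · P(Q)² · P(Q, v and a₃ on opposite sides)`,
  `P₁ = P_A(o ↔ v)`, `P₂ = P_A(b ↔ v)`, `q_all = P_A(o ↔ v, b ↔ v)`

(the four extra masses of `R½` beyond the twelve of `Gc` — `mU(o)`, `mU(b)`, `mU(a₃)`, `mUU` — as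
bilinear forms: `mUo_ob` … `mUU_diag_ob`; then `∑ q = 1`, `∑ r = 1` and `ring`).  Hence the row
on the whole class (**`LeafRow_obFar`**): the diagonal instance is the coincidence row `b = o`
(`LeafRowCoincidences.LeafRow_b_eq_o`, (AA0) at `b = o`), `q_all − P₁ P₂ ≥ 0` is Harris on the
part (`harris_x1_x2`), and the rest is a product of probabilities.  The left side is arbitrary.
Own work; standard axioms.
-/

namespace Summit.Ventures.PercRepro2

open CovForm CutVertexM9 UnionCluster CutTwoFar LeafStep

namespace LeafRowCutTwoFar

section OB

variable {V : Type*} {E : Type*} [Fintype E] [DecidableEq E] {R : Type*} [Field R]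
variable {ends : E → Sym2 V} {side : E → Bool} {L : Set V} {v : V} {Rt : Set V}

/-- `mU(o)` of `R½(o, b far)`. -/
theorem mUo_ob (h : CutVertex ends side L v Rt) (p : E → R) {o b a₁ a₂ a₃ : V} (ho : o ∈ L ∨ o = v) (h1 : a₁ ∈ Rt ∨ a₁ = v) (h2 : a₂ ∈ Rt ∨ a₂ = v) : mU p ends a₁ a₂ o =
    (patProb ends side v o b p ![true, true, true] + patProb ends side v o b p ![true, false, false]) * (ratom ends side v a₁ a₂ a₃ p ![true, false, true, false, true, false] + ratom ends side v a₁ a₂ a₃ p ![true, false, false, false, false, true] + ratom ends side v a₁ a₂ a₃ p ![true, false, false, false, false, false] + ratom ends side v a₁ a₂ a₃ p ![false, true, true, false, false, true] + ratom ends side v a₁ a₂ a₃ p ![false, true, false, false, true, false] + ratom ends side v a₁ a₂ a₃ p ![false, true, false, false, false, false]) := by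
  simp only [mU]
  rw [prob_patLR ends side v a₁ a₂ a₃ o b p (avoidAll ends a₂ {a₁} ∩ connEvent ends a₁ o)
      (fun τ ρ => (¬ (ρ 3 = true) ∧ (τ 0 = true ∧ ρ 0 = true))) (fun ω => by simp only [Set.mem_inter_iff, mem_connEvent, avoidAll, Set.mem_setOf_eq, Finset.mem_singleton, forall_eq, ob_conn_a₂_a₁ h h1 h2 ω (a₃ := a₃), ob_conn_a₁_o h ho h1 ω (b := b) (a₂ := a₂) (a₃ := a₃)]),
    prob_patLR ends side v a₁ a₂ a₃ o b p (avoidAll ends a₂ {a₁} ∩ connEvent ends a₂ o)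
      (fun τ ρ => (¬ (ρ 3 = true) ∧ (τ 0 = true ∧ ρ 1 = true))) (fun ω => by simp only [Set.mem_inter_iff, mem_connEvent, avoidAll, Set.mem_setOf_eq, Finset.mem_singleton, forall_eq, ob_conn_a₂_a₁ h h1 h2 ω (a₃ := a₃), ob_conn_a₂_o h ho h2 ω (b := b) (a₁ := a₁) (a₃ := a₃)])]
  simp only [mix_eq_sum_transPatterns, sum_transPatterns, sum_ite_ratom_eq_sum_transSix, sum_transSix]
  conv_lhs => simp [Fintype.sum_prod_type]
  ring

/-- `mU(b)` of `R½(o, b far)`. -/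
theorem mUb_ob (h : CutVertex ends side L v Rt) (p : E → R) {o b a₁ a₂ a₃ : V} (hb : b ∈ L ∨ b = v) (h1 : a₁ ∈ Rt ∨ a₁ = v) (h2 : a₂ ∈ Rt ∨ a₂ = v) : mU p ends a₁ a₂ b =
    (patProb ends side v o b p ![true, true, true] + patProb ends side v o b p ![false, true, false]) * (ratom ends side v a₁ a₂ a₃ p ![true, false, true, false, true, false] + ratom ends side v a₁ a₂ a₃ p ![true, false, false, false, false, true] + ratom ends side v a₁ a₂ a₃ p ![true, false, false, false, false, false] + ratom ends side v a₁ a₂ a₃ p ![false, true, true, false, false, true] + ratom ends side v a₁ a₂ a₃ p ![false, true, false, false, true, false] + ratom ends side v a₁ a₂ a₃ p ![false, true, false, false, false, false]) := by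
  simp only [mU]
  rw [prob_patLR ends side v a₁ a₂ a₃ o b p (avoidAll ends a₂ {a₁} ∩ connEvent ends a₁ b)
      (fun τ ρ => (¬ (ρ 3 = true) ∧ (τ 1 = true ∧ ρ 0 = true))) (fun ω => by simp only [Set.mem_inter_iff, mem_connEvent, avoidAll, Set.mem_setOf_eq, Finset.mem_singleton, forall_eq, ob_conn_a₂_a₁ h h1 h2 ω (a₃ := a₃), ob_conn_a₁_b h hb h1 ω (o := o) (a₂ := a₂) (a₃ := a₃)]),
    prob_patLR ends side v a₁ a₂ a₃ o b p (avoidAll ends a₂ {a₁} ∩ connEvent ends a₂ b)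
      (fun τ ρ => (¬ (ρ 3 = true) ∧ (τ 1 = true ∧ ρ 1 = true))) (fun ω => by simp only [Set.mem_inter_iff, mem_connEvent, avoidAll, Set.mem_setOf_eq, Finset.mem_singleton, forall_eq, ob_conn_a₂_a₁ h h1 h2 ω (a₃ := a₃), ob_conn_a₂_b h hb h2 ω (o := o) (a₁ := a₁) (a₃ := a₃)])]
  simp only [mix_eq_sum_transPatterns, sum_transPatterns, sum_ite_ratom_eq_sum_transSix, sum_transSix]
  conv_lhs => simp [Fintype.sum_prod_type]
  ring

/-- `mU(a₃)` of `R½(o, b far)` (a right-side mass). -/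
theorem mUa3_ob (h : CutVertex ends side L v Rt) (p : E → R) {a₁ a₂ a₃ : V} (h1 : a₁ ∈ Rt ∨ a₁ = v) (h2 : a₂ ∈ Rt ∨ a₂ = v) (h3 : a₃ ∈ Rt ∨ a₃ = v) : mU p ends a₁ a₂ a₃ =
    ratom ends side v a₁ a₂ a₃ p ![true, false, true, false, true, false] + ratom ends side v a₁ a₂ a₃ p ![true, false, false, false, false, true] + ratom ends side v a₁ a₂ a₃ p ![false, true, true, false, false, true] + ratom ends side v a₁ a₂ a₃ p ![false, true, false, false, true, false] + ratom ends side v a₁ a₂ a₃ p ![false, false, false, false, true, false] + ratom ends side v a₁ a₂ a₃ p ![false, false, false, false, false, true] := by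
  simp only [mU]
  rw [prob_R6 ends side v a₁ a₂ a₃ p (avoidAll ends a₂ {a₁} ∩ connEvent ends a₁ a₃)
      (fun ρ => (¬ (ρ 3 = true) ∧ ρ 4 = true)) (fun ω => by simp only [Set.mem_inter_iff, mem_connEvent, avoidAll, Set.mem_setOf_eq, Finset.mem_singleton, forall_eq, ob_conn_a₂_a₁ h h1 h2 ω (a₃ := a₃), ob_conn_a₁_a₃ h h1 h3 ω (a₂ := a₂)]),
    prob_R6 ends side v a₁ a₂ a₃ p (avoidAll ends a₂ {a₁} ∩ connEvent ends a₂ a₃)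
      (fun ρ => (¬ (ρ 3 = true) ∧ ρ 5 = true)) (fun ω => by simp only [Set.mem_inter_iff, mem_connEvent, avoidAll, Set.mem_setOf_eq, Finset.mem_singleton, forall_eq, ob_conn_a₂_a₁ h h1 h2 ω (a₃ := a₃), ob_conn_a₂_a₃ h h2 h3 ω (a₁ := a₁)])]
  simp only [sum_ite_ratom_eq_sum_transSix, sum_transSix]
  conv_lhs => simp [Fintype.sum_prod_type]
  ring

/-- `mUU` of `R½(o, b far)`. -/
theorem mUU_ob (h : CutVertex ends side L v Rt) (p : E → R) {o b a₁ a₂ a₃ : V} (ho : o ∈ L ∨ o = v) (hb : b ∈ L ∨ b = v) (h1 : a₁ ∈ Rt ∨ a₁ = v) (h2 : a₂ ∈ Rt ∨ a₂ = v) : mUU p ends o a₁ a₂ b =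
    patProb ends side v o b p ![true, true, true] * (ratom ends side v a₁ a₂ a₃ p ![true, false, true, false, true, false] + ratom ends side v a₁ a₂ a₃ p ![true, false, false, false, false, true] + ratom ends side v a₁ a₂ a₃ p ![true, false, false, false, false, false] + ratom ends side v a₁ a₂ a₃ p ![false, true, true, false, false, true] + ratom ends side v a₁ a₂ a₃ p ![false, true, false, false, true, false] + ratom ends side v a₁ a₂ a₃ p ![false, true, false, false, false, false]) := by
  simp only [mUU]
  rw [prob_patLR ends side v a₁ a₂ a₃ o b p (avoidAll ends a₂ {a₁} ∩ (connEvent ends a₁ o ∩ connEvent ends a₁ b))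
      (fun τ ρ => (¬ (ρ 3 = true) ∧ ((τ 0 = true ∧ ρ 0 = true) ∧ (τ 1 = true ∧ ρ 0 = true)))) (fun ω => by simp only [Set.mem_inter_iff, mem_connEvent, avoidAll, Set.mem_setOf_eq, Finset.mem_singleton, forall_eq, ob_conn_a₂_a₁ h h1 h2 ω (a₃ := a₃), ob_conn_a₁_o h ho h1 ω (b := b) (a₂ := a₂) (a₃ := a₃), ob_conn_a₁_b h hb h1 ω (o := o) (a₂ := a₂) (a₃ := a₃)]),
    prob_patLR ends side v a₁ a₂ a₃ o b p (avoidAll ends a₂ {a₁} ∩ (connEvent ends a₂ o ∩ connEvent ends a₂ b))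
      (fun τ ρ => (¬ (ρ 3 = true) ∧ ((τ 0 = true ∧ ρ 1 = true) ∧ (τ 1 = true ∧ ρ 1 = true)))) (fun ω => by simp only [Set.mem_inter_iff, mem_connEvent, avoidAll, Set.mem_setOf_eq, Finset.mem_singleton, forall_eq, ob_conn_a₂_a₁ h h1 h2 ω (a₃ := a₃), ob_conn_a₂_o h ho h2 ω (b := b) (a₁ := a₁) (a₃ := a₃), ob_conn_a₂_b h hb h2 ω (o := o) (a₁ := a₁) (a₃ := a₃)]),
    prob_patLR ends side v a₁ a₂ a₃ o b p (avoidAll ends a₂ {a₁} ∩ (connEvent ends a₂ o ∩ connEvent ends a₁ b))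
      (fun τ ρ => (¬ (ρ 3 = true) ∧ ((τ 0 = true ∧ ρ 1 = true) ∧ (τ 1 = true ∧ ρ 0 = true)))) (fun ω => by simp only [Set.mem_inter_iff, mem_connEvent, avoidAll, Set.mem_setOf_eq, Finset.mem_singleton, forall_eq, ob_conn_a₂_a₁ h h1 h2 ω (a₃ := a₃), ob_conn_a₂_o h ho h2 ω (b := b) (a₁ := a₁) (a₃ := a₃), ob_conn_a₁_b h hb h1 ω (o := o) (a₂ := a₂) (a₃ := a₃)]),
    prob_patLR ends side v a₁ a₂ a₃ o b p (avoidAll ends a₂ {a₁} ∩ (connEvent ends a₁ o ∩ connEvent ends a₂ b))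
      (fun τ ρ => (¬ (ρ 3 = true) ∧ ((τ 0 = true ∧ ρ 0 = true) ∧ (τ 1 = true ∧ ρ 1 = true)))) (fun ω => by simp only [Set.mem_inter_iff, mem_connEvent, avoidAll, Set.mem_setOf_eq, Finset.mem_singleton, forall_eq, ob_conn_a₂_a₁ h h1 h2 ω (a₃ := a₃), ob_conn_a₁_o h ho h1 ω (b := b) (a₂ := a₂) (a₃ := a₃), ob_conn_a₂_b h hb h2 ω (o := o) (a₁ := a₁) (a₃ := a₃)])]
  simp only [mix_eq_sum_transPatterns, sum_transPatterns, sum_ite_ratom_eq_sum_transSix, sum_transSix]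
  conv_lhs => simp [Fintype.sum_prod_type]
  ring

/-- `mU(v)` of the diagonal instance `R½(o := v, b := v)`. -/
theorem mUv_diag_ob (h : CutVertex ends side L v Rt) (p : E → R) {a₁ a₂ a₃ : V} (h1 : a₁ ∈ Rt ∨ a₁ = v) (h2 : a₂ ∈ Rt ∨ a₂ = v) : mU p ends a₁ a₂ v =
    ratom ends side v a₁ a₂ a₃ p ![true, false, true, false, true, false] + ratom ends side v a₁ a₂ a₃ p ![true, false, false, false, false, true] + ratom ends side v a₁ a₂ a₃ p ![true, false, false, false, false, false] + ratom ends side v a₁ a₂ a₃ p ![false, true, true, false, false, true] + ratom ends side v a₁ a₂ a₃ p ![false, true, false, false, true, false] + ratom ends side v a₁ a₂ a₃ p ![false, true, false, false, false, false] := by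
  simp only [mU]
  rw [prob_R6 ends side v a₁ a₂ a₃ p (avoidAll ends a₂ {a₁} ∩ connEvent ends a₁ v)
      (fun ρ => (¬ (ρ 3 = true) ∧ ρ 0 = true)) (fun ω => by simp only [Set.mem_inter_iff, mem_connEvent, avoidAll, Set.mem_setOf_eq, Finset.mem_singleton, forall_eq, ob_conn_a₂_a₁ h h1 h2 ω (a₃ := a₃), ob_conn_a₁_v h h1 ω (a₂ := a₂) (a₃ := a₃)]),
    prob_R6 ends side v a₁ a₂ a₃ p (avoidAll ends a₂ {a₁} ∩ connEvent ends a₂ v)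
      (fun ρ => (¬ (ρ 3 = true) ∧ ρ 1 = true)) (fun ω => by simp only [Set.mem_inter_iff, mem_connEvent, avoidAll, Set.mem_setOf_eq, Finset.mem_singleton, forall_eq, ob_conn_a₂_a₁ h h1 h2 ω (a₃ := a₃), ob_conn_a₂_v h h2 ω (a₁ := a₁) (a₃ := a₃)])]
  simp only [sum_ite_ratom_eq_sum_transSix, sum_transSix]
  conv_lhs => simp [Fintype.sum_prod_type]
  ring

/-- `mUU` of the diagonal instance `R½(o := v, b := v)`. -/
theorem mUU_diag_ob (h : CutVertex ends side L v Rt) (p : E → R) {a₁ a₂ a₃ : V} (h1 : a₁ ∈ Rt ∨ a₁ = v) (h2 : a₂ ∈ Rt ∨ a₂ = v) : mUU p ends v a₁ a₂ v =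
    ratom ends side v a₁ a₂ a₃ p ![true, false, true, false, true, false] + ratom ends side v a₁ a₂ a₃ p ![true, false, false, false, false, true] + ratom ends side v a₁ a₂ a₃ p ![true, false, false, false, false, false] + ratom ends side v a₁ a₂ a₃ p ![false, true, true, false, false, true] + ratom ends side v a₁ a₂ a₃ p ![false, true, false, false, true, false] + ratom ends side v a₁ a₂ a₃ p ![false, true, false, false, false, false] := by
  simp only [mUU]
  rw [prob_R6 ends side v a₁ a₂ a₃ p (avoidAll ends a₂ {a₁} ∩ (connEvent ends a₁ v ∩ connEvent ends a₁ v))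
      (fun ρ => (¬ (ρ 3 = true) ∧ (ρ 0 = true ∧ ρ 0 = true))) (fun ω => by simp only [Set.mem_inter_iff, mem_connEvent, avoidAll, Set.mem_setOf_eq, Finset.mem_singleton, forall_eq, ob_conn_a₂_a₁ h h1 h2 ω (a₃ := a₃), ob_conn_a₁_v h h1 ω (a₂ := a₂) (a₃ := a₃)]),
    prob_R6 ends side v a₁ a₂ a₃ p (avoidAll ends a₂ {a₁} ∩ (connEvent ends a₂ v ∩ connEvent ends a₂ v))
      (fun ρ => (¬ (ρ 3 = true) ∧ (ρ 1 = true ∧ ρ 1 = true))) (fun ω => by simp only [Set.mem_inter_iff, mem_connEvent, avoidAll, Set.mem_setOf_eq, Finset.mem_singleton, forall_eq, ob_conn_a₂_a₁ h h1 h2 ω (a₃ := a₃), ob_conn_a₂_v h h2 ω (a₁ := a₁) (a₃ := a₃)]),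
    prob_R6 ends side v a₁ a₂ a₃ p (avoidAll ends a₂ {a₁} ∩ (connEvent ends a₂ v ∩ connEvent ends a₁ v))
      (fun ρ => (¬ (ρ 3 = true) ∧ (ρ 1 = true ∧ ρ 0 = true))) (fun ω => by simp only [Set.mem_inter_iff, mem_connEvent, avoidAll, Set.mem_setOf_eq, Finset.mem_singleton, forall_eq, ob_conn_a₂_a₁ h h1 h2 ω (a₃ := a₃), ob_conn_a₂_v h h2 ω (a₁ := a₁) (a₃ := a₃), ob_conn_a₁_v h h1 ω (a₂ := a₂) (a₃ := a₃)]),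
    prob_R6 ends side v a₁ a₂ a₃ p (avoidAll ends a₂ {a₁} ∩ (connEvent ends a₁ v ∩ connEvent ends a₂ v))
      (fun ρ => (¬ (ρ 3 = true) ∧ (ρ 0 = true ∧ ρ 1 = true))) (fun ω => by simp only [Set.mem_inter_iff, mem_connEvent, avoidAll, Set.mem_setOf_eq, Finset.mem_singleton, forall_eq, ob_conn_a₂_a₁ h h1 h2 ω (a₃ := a₃), ob_conn_a₁_v h h1 ω (a₂ := a₂) (a₃ := a₃), ob_conn_a₂_v h h2 ω (a₁ := a₁) (a₃ := a₃)])]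
  simp only [sum_ite_ratom_eq_sum_transSix, sum_transSix]
  conv_lhs => simp [Fintype.sum_prod_type]
  ring

/-- **THE DIAGONAL REDUCTION OF `R½`** (`o, b` behind the cut vertex `v`; `a₁, a₂, a₃` on the right or at `v`):
`R½ = P₁ P₂ · R½(o := v, b := v) + (q_all − P₁ P₂) · P(Q)² · P(Q, v ∈ U, a₃ ∈ U, opposite sides)`,
`P₁ = q_all + q_x1 = P_A(o ↔ v)`, `P₂ = q_all + q_x2 = P_A(b ↔ v)`. -/
theorem Rhalf_obFar_eq [LinearOrder R] [IsStrictOrderedRing R] (h : CutVertex ends side L v Rt)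
    (p : E → R) {o b a₁ a₂ a₃ : V}
    (ho : o ∈ L ∨ o = v) (hb : b ∈ L ∨ b = v) (h1 : a₁ ∈ Rt ∨ a₁ = v) (h2 : a₂ ∈ Rt ∨ a₂ = v)
    (h3 : a₃ ∈ Rt ∨ a₃ = v) :
    Rhalf p ends o a₁ a₂ a₃ b =
      (patProb ends side v o b p ![true, true, true] + patProb ends side v o b p ![true, false, false]) *
          (patProb ends side v o b p ![true, true, true] + patProb ends side v o b p ![false, true, false]) *
          Rhalf p ends v a₁ a₂ a₃ v +
        (patProb ends side v o b p ![true, true, true] -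
            (patProb ends side v o b p ![true, true, true] + patProb ends side v o b p ![true, false, false]) *
              (patProb ends side v o b p ![true, true, true] + patProb ends side v o b p ![false, true, false])) *
          (prob p (avoidAll ends a₂ {a₁}) ^ 2 *
            prob p (avoidAll ends a₂ {a₁} ∩ ((connEvent ends a₁ v ∩ connEvent ends a₂ a₃) ∪ (connEvent ends a₂ v ∩ connEvent ends a₁ a₃)))) := by
  have hq := sum_patProb_transPatterns ends side v o b p
  rw [sum_transPatterns] at hq
  have hr := ratom_sum_transSix ends side v a₁ a₂ a₃ p
  rw [sum_transSix] at hr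
  have hqs : patProb ends side v o b p ![false, false, false] = 1 - (patProb ends side v o b p ![true, true, true] + patProb ends side v o b p ![true, false, false] + patProb ends side v o b p ![false, true, false] + patProb ends side v o b p ![false, false, true]) := by
    linear_combination hq
  have hrs : ratom ends side v a₁ a₂ a₃ p ![false, false, false, false, false, false] = 1 - (ratom ends side v a₁ a₂ a₃ p ![true, true, true, true, true, true] + ratom ends side v a₁ a₂ a₃ p ![true, true, false, true, false, false] + ratom ends side v a₁ a₂ a₃ p ![true, false, true, false, true, false] + ratom ends side v a₁ a₂ a₃ p ![true, false, false, false, false, true] + ratom ends side v a₁ a₂ a₃ p ![true, false, false, false, false, false] + ratom ends side v a₁ a₂ a₃ p ![false, true, true, false, false, true] + ratom ends side v a₁ a₂ a₃ p ![false, true, false, false, true, false] + ratom ends side v a₁ a₂ a₃ p ![false, true, false, false, false, false] + ratom ends side v a₁ a₂ a₃ p ![false, false, true, true, false, false] + ratom ends side v a₁ a₂ a₃ p ![false, false, true, false, false, false] + ratom ends side v a₁ a₂ a₃ p ![false, false, false, true, true, true] + ratom ends side v a₁ a₂ a₃ p ![false, false, false, true, false, false] + ratom ends side v a₁ a₂ a₃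 p ![false, false, false, false, true, false] + ratom ends side v a₁ a₂ a₃ p ![false, false, false, false, false, true]) := by
    linear_combination hr
  unfold Rhalf T0 Gc1
  rw [PQ_ob (o := o) (b := b) (a₃ := a₃) h p h1 h2,
    EQbo_ob (a₃ := a₃) h p ho hb h1 h2,
    EQb3_ob (o := o) h p hb h1 h2 h3,
    EQb3o_ob h p ho hb h1 h2 h3,
    gap_ob (o := o) (a₃ := a₃) h p hb h1 h2,
    EQo_ob (b := b) (a₃ := a₃) h p ho h1 h2,
    EQ3_ob (o := o) (b := b) h p h1 h2 h3,
    EQ3o_ob (b := b) h p ho h1 h2 h3,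
    PDb_ob (o := o) h p hb h1 h2 h3,
    PDbo_ob h p ho hb h1 h2 h3,
    Do_ob (b := b) h p ho h1 h2 h3,
    mUo_ob (b := b) (a₃ := a₃) h p ho h1 h2,
    mUb_ob (o := o) (a₃ := a₃) h p hb h1 h2,
    mUa3_ob h p h1 h2 h3,
    mUU_ob (a₃ := a₃) h p ho hb h1 h2,
    Do_diag h p h1 h2 h3,
    EQbo_diag (a₃ := a₃) h p h1 h2,
    EQb3_diag h p h1 h2 h3,
    EQb3o_diag h p h1 h2 h3,
    gap_diag (a₃ := a₃) h p h1 h2,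
    EQo_diag (a₃ := a₃) h p h1 h2,
    EQ3o_diag h p h1 h2 h3,
    PDb_diag h p h1 h2 h3,
    PDbo_diag h p h1 h2 h3,
    mUv_diag_ob (a₃ := a₃) h p h1 h2,
    mUU_diag_ob (a₃ := a₃) h p h1 h2,
    OPP_ob h p h1 h2 h3, hqs, hrs]
  ring

/-- **Row (LEAF-½) with `o` and `b` together behind a cut vertex**, every admissible weight
vector, the left side arbitrary: the coincidence row `b = o` at the cut vertex, Harris on the part,
and a product of probabilities. -/
theorem LeafRow_obFar [Fintype V] [DecidableEq V] [LinearOrder R] [IsStrictOrderedRing R]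
    (h : CutVertex ends side L v Rt) {p : E → R} (hp : IsProbVec p) {o b a₁ a₂ a₃ : V}
    (ho : o ∈ L ∨ o = v) (hb : b ∈ L ∨ b = v) (h1 : a₁ ∈ Rt ∨ a₁ = v) (h2 : a₂ ∈ Rt ∨ a₂ = v)
    (h3 : a₃ ∈ Rt ∨ a₃ = v) : LeafRow p ends o a₁ a₂ a₃ b := by
  unfold LeafRow
  rw [Rhalf_obFar_eq h p ho hb h1 h2 h3]
  have hΘ : 0 ≤ Rhalf p ends v a₁ a₂ a₃ v :=
    LeafRowCoincidences.LeafRow_b_eq_o p ends hp a₁ a₂ a₃ v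
  have hH := harris_x1_x2 ends side v o b hp
  have hq : ∀ τ, 0 ≤ patProb ends side v o b p τ := fun τ => prob_nonneg hp _
  have hPQ := sq_nonneg (prob p (avoidAll ends a₂ {a₁}))
  have hO := prob_nonneg hp (avoidAll ends a₂ {a₁} ∩ ((connEvent ends a₁ v ∩ connEvent ends a₂ a₃) ∪ (connEvent ends a₂ v ∩ connEvent ends a₁ a₃)))
  exact add_nonneg (mul_nonneg (mul_nonneg (add_nonneg (hq _) (hq _)) (add_nonneg (hq _) (hq _))) hΘ)
    (mul_nonneg (sub_nonneg.2 hH) (mul_nonneg hPQ hO))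

end OB

end LeafRowCutTwoFar

end Summit.Ventures.PercRepro2
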